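import Literature.Algebra.Homology.OrderedCechPairSystemFunctor
import Literature.Algebra.Homology.OrderedCechPairSystemBounds
import Literature.Algebra.Homology.TotalQuasiIsoOfBoundedColumns
import HarnessLib

/-!
# Complexes of pair-systems: the iterated ordered Čech bicomplex, its bicomplex of totals, and the corner complexes
# (Stacks 0BEC, 012K, 012Z)

Layer `Literature/Algebra/Homology` (constructions + `rfl` identifications + degree bounds; 0 named facts, no instance, no
notation; pure homological algebra over a commutative ring `A`). For a COCHAIN COMPLEX of pair-systems
`Q : CochainComplex (Finset ι ⥤ Finset κ ⥤ ModuleCat A) ℤ` (`q ↦ Q^q`) the ordered Čech bicomplex `Č•,• = sysBicomplexFunctor A ι κ`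
(`Algebra/Homology/OrderedCechPairSystem(Functor)`) applied termwise gives three commuting differentials (in `q`, in the `σ`-degree
`a`, in the `τ`-degree `b`), packaged as iterated bicomplexes (all differentials are the `mapHomologicalComplex` ones, `rfl`):
* `evalEmptyEmpty A ι κ : P ↦ P ∅ ∅`, `evalEmpty₂ A ι κ : P ↦ P(·, ∅)` (additivity as theorems), the corner complex
  **`emptyComplex Q`** (`q ↦ Q^q ∅ ∅`) and the `∅`-column bicomplex **`emptyColBicomplex Q`** (`(q, a) ↦ Čᵃ(Q^q(·, ∅))`);
* **`cechTricomplex Q`** — `q ↦ Č•,•(Q^q)`, a bicomplex in `(q, a)` with values in `b`-complexes; Mathlib's `flip` re-brackets it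
  as `a ↦ (q ↦ (b ↦ ·))`; **`cechTotBicomplex Q`** — `(a, m) ↦ Tot_{(q, b) ↦ m} Čᵃ,ᵇ(Q^q)`, the total complexes of the columns of
  the flip (Mathlib `HomologicalComplex₂.totalFunctor` termwise; zero morphisms by the tree's `TotalQuasiIsoOfColumns.total_map_zero`);
* the first-quadrant DEGREE BOUNDS of all of them from `Q.IsStrictlyGE q₀` and `Algebra/Homology/OrderedCechPairSystemBounds` — the
  boundedness hypotheses of the criteria of `Algebra/Homology/TotalQuasiIsoOfBoundedColumns`.

No quasi-isomorphism is asserted in this file. Library only (cell `pub-hodge-ring2`, count-neutral); proves nothing about any crux,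
route or conjecture. Mathlib searched (pin v4.32): `Functor.mapHomologicalComplex`, `HomologicalComplex₂.flip`, `totalFunctor`,
`CategoryTheory.flipFunctor`, `evaluation`, `Functor.map_isZero` (used).

## References

* The Stacks Project, Tag 0BEC (Künneth: the double Čech complex), Tag 012K (double complexes), Tag 012Z (total complex). [StacksProject]
* C. A. Weibel, *An introduction to homological algebra* (1994), 1.2.6, 5.6 (double complexes, total complex). [Weibel1994]
* U. Görtz, T. Wedhorn, *Algebraic Geometry II* (2023), Def. 21.68 (p. 180). [GortzWedhorn2023]
-/

universe u

open CategoryTheory CategoryTheory.Limits HomologicalComplex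

set_option backward.isDefEq.respectTransparency false

noncomputable section

namespace Literature.Algebra.Homology

namespace OrderedCech

variable {A : Type u} [CommRing A] {ι κ : Type} (Q : CochainComplex (Finset ι ⥤ Finset κ ⥤ ModuleCat.{u} A) ℤ)

variable (A ι κ) in
/-- **`P ↦ P ∅ ∅`**, the corner member of a pair-system, as a functor (two `evaluation`s). [cite: StacksProject, Tag 0BEC] -/
def evalEmptyEmpty : (Finset ι ⥤ Finset κ ⥤ ModuleCat.{u} A) ⥤ ModuleCat.{u} A :=
  (evaluation _ _).obj ∅ ⋙ (evaluation _ _).obj ∅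

variable (A ι κ) in
/-- **`P ↦ P(·, ∅)`**, the `∅`-column `ι`-system of a pair-system, as a functor (`flipFunctor ⋙ evaluation ∅`). [cite: StacksProject, Tag 0BEC] -/
def evalEmpty₂ : (Finset ι ⥤ Finset κ ⥤ ModuleCat.{u} A) ⥤ (Finset ι ⥤ ModuleCat.{u} A) :=
  flipFunctor _ _ _ ⋙ (evaluation _ _).obj ∅

/-- `evalEmptyEmpty` is additive (a theorem; no instance is declared). [cite: StacksProject, Tag 012K] -/
theorem additive_evalEmptyEmpty : (evalEmptyEmpty A ι κ).Additive := ⟨rfl⟩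

/-- `evalEmpty₂` is additive (a theorem; no instance is declared). [cite: StacksProject, Tag 012K] -/
theorem additive_evalEmpty₂ : (evalEmpty₂ A ι κ).Additive := ⟨rfl⟩

/-- **The corner complex `q ↦ Q^q ∅ ∅`** of a complex of pair-systems. [cite: StacksProject, Tag 0BEC] -/
def emptyComplex : CochainComplex (ModuleCat.{u} A) ℤ :=
  haveI := additive_evalEmptyEmpty (A := A) (ι := ι) (κ := κ)
  ((evalEmptyEmpty A ι κ).mapHomologicalComplex (ComplexShape.up ℤ)).obj Q

/-- The terms of the corner complex (`rfl`). [cite: StacksProject, Tag 0BEC] -/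
@[simp] theorem emptyComplex_X (q : ℤ) : (emptyComplex Q).X q = ((Q.X q).obj ∅).obj ∅ := rfl

/-- The corner complex is in degrees `≥ q₀` when `Q` is. [cite: Weibel1994, 1.2.6] -/
theorem isStrictlyGE_emptyComplex (q₀ : ℤ) [Q.IsStrictlyGE q₀] : CochainComplex.IsStrictlyGE (emptyComplex Q) q₀ :=
  haveI := additive_evalEmptyEmpty (A := A) (ι := ι) (κ := κ)
  (CochainComplex.isStrictlyGE_iff _ _).2 fun q hq =>
    Functor.map_isZero (evalEmptyEmpty A ι κ) (Q.isZero_of_isStrictlyGE q₀ q hq)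

section EmptyCol

variable [LinearOrder ι]

/-- `Č•` of the zero morphism of `ι`-systems is zero. [cite: GortzWedhorn2023, Def. 21.68 (p. 180)] -/
theorem sysComplexMap_zero {M M' : Finset ι ⥤ ModuleCat.{u} A} : sysComplexMap (0 : M ⟶ M') = 0 := by
  ext n g; rfl

/-- `M ↦ Č•(M)` preserves zero morphisms (a theorem, no instance). [cite: GortzWedhorn2023, Def. 21.68 (p. 180)] -/
theorem preservesZeroMorphisms_sysComplexFunctor : (sysComplexFunctor A ι).PreservesZeroMorphisms :=
  ⟨fun _ _ => sysComplexMap_zero⟩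

/-- **`(q, a) ↦ Čᵃ(Q^q(·, ∅))`**: the ordered Čech complexes of the `∅`-column `ι`-systems, termwise in `q` (a bicomplex with outer
index `q`). [cite: StacksProject, Tag 0BEC] [cite: GortzWedhorn2023, Def. 21.68 (p. 180)] -/
def emptyColBicomplex : HomologicalComplex₂ (ModuleCat.{u} A) (ComplexShape.up ℤ) (ComplexShape.up ℤ) :=
  haveI := additive_evalEmpty₂ (A := A) (ι := ι) (κ := κ)
  haveI := preservesZeroMorphisms_sysComplexFunctor (A := A) (ι := ι)
  ((evalEmpty₂ A ι κ ⋙ sysComplexFunctor A ι).mapHomologicalComplex (ComplexShape.up ℤ)).obj Q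

/-- The columns of `emptyColBicomplex Q` are the Čech complexes `Č•(Q^q(·, ∅))` (`rfl`). [cite: StacksProject, Tag 0BEC] -/
@[simp] theorem emptyColBicomplex_X (q : ℤ) : (emptyColBicomplex Q).X q = sysComplex ((Q.X q).flip.obj ∅) := rfl

/-- `emptyColBicomplex Q` has its columns in degrees `≥ q₀` when `Q` does. [cite: Weibel1994, 1.2.6] -/
theorem isStrictlyGE_emptyColBicomplex (q₀ : ℤ) [Q.IsStrictlyGE q₀] :
    CochainComplex.IsStrictlyGE (emptyColBicomplex Q) q₀ :=
  haveI := additive_evalEmpty₂ (A := A) (ι := ι) (κ := κ)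
  haveI := preservesZeroMorphisms_sysComplexFunctor (A := A) (ι := ι)
  (CochainComplex.isStrictlyGE_iff _ _).2 fun q hq =>
    Functor.map_isZero (evalEmpty₂ A ι κ ⋙ sysComplexFunctor A ι) (Q.isZero_of_isStrictlyGE q₀ q hq)

/-- Every column `Č•(Q^q(·, ∅))` is in degrees `≥ 0`. [cite: GortzWedhorn2023, Def. 21.68 (p. 180)] -/
theorem isStrictlyGE_emptyColBicomplex_X (q : ℤ) : CochainComplex.IsStrictlyGE ((emptyColBicomplex Q).X q) 0 :=
  isStrictlyGE_sysComplex _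

/-- The flip of `emptyColBicomplex Q` (outer index `a`) has no columns in negative degree. [cite: Weibel1994, 1.2.6] -/
theorem isStrictlyGE_emptyColBicomplex_flip : CochainComplex.IsStrictlyGE (emptyColBicomplex Q).flip 0 :=
  isStrictlyGE_flip _ 0 fun q => isStrictlyGE_emptyColBicomplex_X Q q

/-- The columns `q ↦ Čᵃ(Q^q(·, ∅))` of the flip are in degrees `≥ q₀` when `Q` is. [cite: Weibel1994, 1.2.6] -/
theorem isStrictlyGE_emptyColBicomplex_flip_X (q₀ : ℤ) [Q.IsStrictlyGE q₀] (a : ℤ) :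
    CochainComplex.IsStrictlyGE ((emptyColBicomplex Q).flip.X a) q₀ :=
  haveI := isStrictlyGE_emptyColBicomplex Q q₀
  isStrictlyGE_flip_X (emptyColBicomplex Q) q₀ a

end EmptyCol

section Cech

variable [LinearOrder ι] [LinearOrder κ]

/-- `Č•,•` preserves zero morphisms (`sysBicomplexMap_zero`; a theorem, no instance). [cite: StacksProject, Tag 012K] -/
theorem preservesZeroMorphisms_sysBicomplexFunctor : (sysBicomplexFunctor A ι κ).PreservesZeroMorphisms :=
  ⟨fun _ _ => sysBicomplexMap_zero⟩

/-- `Tot` preserves zero morphisms (`TotalQuasiIsoOfColumns.total_map_zero`; a theorem, no instance). [cite: StacksProject, Tag 012Z] -/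
theorem preservesZeroMorphisms_totalFunctor :
    (HomologicalComplex₂.totalFunctor (ModuleCat.{u} A) (ComplexShape.up ℤ) (ComplexShape.up ℤ)
      (ComplexShape.up ℤ)).PreservesZeroMorphisms :=
  ⟨fun K L => total_map_zero K L⟩

/-- **`q ↦ Č•,•(Q^q)`** as a bicomplex in `(q, a)` with values in cochain complexes (the `τ`-degree `b`).
[cite: StacksProject, Tag 0BEC] [cite: StacksProject, Tag 012K] -/
def cechTricomplex : HomologicalComplex₂ (CochainComplex (ModuleCat.{u} A) ℤ) (ComplexShape.up ℤ) (ComplexShape.up ℤ) :=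
  haveI := preservesZeroMorphisms_sysBicomplexFunctor (A := A) (ι := ι) (κ := κ)
  ((sysBicomplexFunctor A ι κ).mapHomologicalComplex (ComplexShape.up ℤ)).obj Q

/-- The columns of `cechTricomplex Q` are the bicomplexes `Č•,•(Q^q)` (`rfl`). [cite: StacksProject, Tag 0BEC] -/
@[simp] theorem cechTricomplex_X (q : ℤ) : (cechTricomplex Q).X q = sysBicomplex (Q.X q) := rfl

/-- **The bicomplex of totals `(a, m) ↦ Tot_{(q, b) ↦ m} Čᵃ,ᵇ(Q^q)`**: Mathlib's total-complex functor applied to the columns of the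
flip of `cechTricomplex Q`. [cite: StacksProject, Tag 012Z] [cite: Weibel1994, 5.6] -/
def cechTotBicomplex : HomologicalComplex₂ (ModuleCat.{u} A) (ComplexShape.up ℤ) (ComplexShape.up ℤ) :=
  haveI := preservesZeroMorphisms_totalFunctor (A := A)
  ((HomologicalComplex₂.totalFunctor (ModuleCat.{u} A) (ComplexShape.up ℤ) (ComplexShape.up ℤ)
    (ComplexShape.up ℤ)).mapHomologicalComplex (ComplexShape.up ℤ)).obj (cechTricomplex Q).flip

/-- The columns of `cechTotBicomplex Q` are the total complexes of the columns of the flip (`rfl`). [cite: StacksProject, Tag 012Z] -/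
@[simp] theorem cechTotBicomplex_X (a : ℤ) :
    (cechTotBicomplex Q).X a = HomologicalComplex₂.total ((cechTricomplex Q).flip.X a) (ComplexShape.up ℤ) := rfl

/-- `cechTricomplex Q` has its columns in degrees `≥ q₀` when `Q` does. [cite: Weibel1994, 1.2.6] -/
theorem isStrictlyGE_cechTricomplex (q₀ : ℤ) [Q.IsStrictlyGE q₀] : CochainComplex.IsStrictlyGE (cechTricomplex Q) q₀ :=
  haveI := preservesZeroMorphisms_sysBicomplexFunctor (A := A) (ι := ι) (κ := κ)
  (CochainComplex.isStrictlyGE_iff _ _).2 fun q hq =>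
    Functor.map_isZero (sysBicomplexFunctor A ι κ) (Q.isZero_of_isStrictlyGE q₀ q hq)

/-- The flip of `cechTricomplex Q` has no columns in negative `σ`-degree. [cite: Weibel1994, 1.2.6] -/
theorem isStrictlyGE_cechTricomplex_flip : CochainComplex.IsStrictlyGE (cechTricomplex Q).flip 0 :=
  isStrictlyGE_flip _ 0 fun q => isStrictlyGE_sysBicomplex (Q.X q)

/-- The columns of the flip are in degrees `≥ q₀` (in `q`) when `Q` is. [cite: Weibel1994, 1.2.6] -/
theorem isStrictlyGE_cechTricomplex_flip_X (q₀ : ℤ) [Q.IsStrictlyGE q₀] (a : ℤ) :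
    CochainComplex.IsStrictlyGE ((cechTricomplex Q).flip.X a) q₀ :=
  haveI := isStrictlyGE_cechTricomplex Q q₀
  isStrictlyGE_flip_X (cechTricomplex Q) q₀ a

/-- The entries `Čᵃ,ᵇ(Q^q)` vanish for `q < q₀` when `Q` is in degrees `≥ q₀`. [cite: Weibel1994, 1.2.6] -/
theorem isZero_cechTricomplex_X_X_X (q₀ : ℤ) [Q.IsStrictlyGE q₀] (q a b : ℤ) (hq : q < q₀) :
    IsZero ((((cechTricomplex Q).X q).X a).X b) :=
  haveI := isStrictlyGE_cechTricomplex Q q₀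
  isZero_X_X_of_isZero_X _ (Functor.map_isZero (HomologicalComplex.eval _ _ a)
    (CochainComplex.isZero_of_isStrictlyGE (cechTricomplex Q) q₀ q hq)) b

/-- `cechTotBicomplex Q` has no columns in negative `σ`-degree. [cite: Weibel1994, 1.2.6] -/
theorem isStrictlyGE_cechTotBicomplex : CochainComplex.IsStrictlyGE (cechTotBicomplex Q) 0 :=
  (CochainComplex.isStrictlyGE_iff _ _).2 fun a ha => (IsZero.iff_id_eq_zero _).2 (HomologicalComplex.hom_ext _ _ fun m =>
    (isZero_total_X_of_isZero_X_X _ m fun q b _ => isZero_sysBicomplex_X_X_of_neg_left (Q.X q) a b ha).eq_of_src _ _)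

/-- The columns `Tot_{(q, b)} Čᵃ,ᵇ(Q^q)` of `cechTotBicomplex Q` are in degrees `≥ 0` when `Q` is. [cite: Weibel1994, 1.2.6] -/
theorem isStrictlyGE_cechTotBicomplex_X [Q.IsStrictlyGE 0] (a : ℤ) :
    CochainComplex.IsStrictlyGE ((cechTotBicomplex Q).X a) 0 :=
  (CochainComplex.isStrictlyGE_iff _ _).2 fun m hm =>
    isZero_total_X_of_isZero_X_X _ m fun q b hqb => by
      rcases lt_or_ge q 0 with hq | hq
      · exact isZero_cechTricomplex_X_X_X Q 0 q a b hq
      · exact isZero_sysBicomplex_X_X_of_neg_right (Q.X q) a b (by omega)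

end Cech

end OrderedCech
end Literature.Algebra.Homology
end
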